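import Summits.QuantumAdvantage.AdviceFreeQNC0.AffBells22CoordProduct
import HarnessLib

/-!
# Cell qa-qnc0, `p = 3` — the REAL ALIGNMENT BOUND: a bounded REAL function on a cube cannot align with a non-trivial
# `𝔽₃`-phase beyond `√3/2` (prover qn-prover-3 g26; generic tool, no cell objects)

`AffBells22.norm_sum_coordProduct_mul_char_le` and LEMMA JPD bound `Σ_v Ψ(v)·ω^{Σ_i [v_i]γ_i}` for `±1` COORDINATE PRODUCTS `Ψ`.  For the
"knowing zone" of planner qa-qnc0-p1's ROUND-38 §6 (a coalition of bells that jointly compute an ARBITRARY function of a cell of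
letters; Claim K `Blind39.FewTermJuntaBound` after averaging the untwisted private letters, which produces REAL values in `[−1,1]`)
one needs the same one-coordinate gain for an arbitrary bounded real function:

* `norm_sign_add_real_mul_char_le`, `norm_real_add_real_mul_char_le` — `‖a + b·ω^δ‖ ≤ √3` for REAL `a, b ∈ [−1,1]`, `δ ≠ 0`
  (convexity from the `±1` case `norm_sign_add_sign_mul_char_le`; false for complex `a, b`: `1 + ω̄^δ·ω^δ = 2`);
* `update_not_involutive`, `sum_update_not` (the flip at one coordinate); **`norm_sum_real_mul_char_le`** — for every `F : {0,1}^ι → [−1,1]` and every `γ` with some `γ_{i₀} ≠ 0`,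
  `‖Σ_v F(v)·ω^{Σ_i [v_i]γ_i}‖ ≤ (√3/2)·2^{|ι|}` (pair `v` with its flip at `i₀`; the two phases differ by `ω^{±γ_{i₀}}`).

So a single cell of twisted letters read by arbitrarily many bells with arbitrary tables contributes at most `√3/2`, and the same holds
after any real averaging — the one-cell case of Claim K with `κ = √3/2`.

WHAT THIS IS NOT: no multi-cell statement (that is the transversal / cap-set book-keeping of `R1CellReads39`); crux untouched.
-/

noncomputable section

namespace Summit.QuantumAdvantage.AdviceFreeQNC0

open Finset
open Literature.Computability.MetaComplexity

namespace AffBells22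

variable {ι : Type*} [Fintype ι] [DecidableEq ι]

/-! ## One coordinate: real coefficients -/

omit [Fintype ι] [DecidableEq ι] in
/-- `‖σ + b·ω^δ‖ ≤ √3` for a sign `σ = ±1`, a real `b ∈ [−1,1]` and `δ ≠ 0` (convex combination of the two `±1` cases). -/
theorem norm_sign_add_real_mul_char_le (σ : ℂ) (hσ : σ = 1 ∨ σ = -1) (b : ℝ) (hb : |b| ≤ 1) {δ : ZMod 3} (hδ : δ ≠ 0) :
    ‖σ + (b : ℂ) * (ZMod.stdAddChar δ : ℂ)‖ ≤ Real.sqrt 3 := by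
  set χ : ℂ := (ZMod.stdAddChar δ : ℂ) with hχ
  have hp : ‖σ + 1 * χ‖ ≤ Real.sqrt 3 := by
    have h := norm_sign_add_sign_mul_char_le σ 1 hσ (Or.inl rfl) δ
    rwa [if_pos hδ] at h
  have hm : ‖σ + (-1) * χ‖ ≤ Real.sqrt 3 := by
    have h := norm_sign_add_sign_mul_char_le σ (-1) hσ (Or.inr rfl) δ
    rwa [if_pos hδ] at h
  have hb1 : -1 ≤ b ∧ b ≤ 1 := abs_le.mp hb
  have hdec : σ + (b : ℂ) * χ = (((1 + b) / 2 : ℝ) : ℂ) * (σ + 1 * χ) + (((1 - b) / 2 : ℝ) : ℂ) * (σ + (-1) * χ) := by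
    push_cast; ring
  rw [hdec]
  have h1 : (0 : ℝ) ≤ (1 + b) / 2 := by linarith
  have h2 : (0 : ℝ) ≤ (1 - b) / 2 := by linarith
  calc ‖(((1 + b) / 2 : ℝ) : ℂ) * (σ + 1 * χ) + (((1 - b) / 2 : ℝ) : ℂ) * (σ + (-1) * χ)‖
      ≤ ‖(((1 + b) / 2 : ℝ) : ℂ) * (σ + 1 * χ)‖ + ‖(((1 - b) / 2 : ℝ) : ℂ) * (σ + (-1) * χ)‖ := norm_add_le _ _
    _ = (1 + b) / 2 * ‖σ + 1 * χ‖ + (1 - b) / 2 * ‖σ + (-1) * χ‖ := by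
        rw [norm_mul, norm_mul, Complex.norm_real, Complex.norm_real, Real.norm_of_nonneg h1, Real.norm_of_nonneg h2]
    _ ≤ (1 + b) / 2 * Real.sqrt 3 + (1 - b) / 2 * Real.sqrt 3 := by gcongr
    _ = Real.sqrt 3 := by ring

omit [Fintype ι] [DecidableEq ι] in
/-- **`‖a + b·ω^δ‖ ≤ √3`** for REAL `a, b ∈ [−1,1]` and `δ ≠ 0` in `𝔽₃`.  (For complex unit coefficients the bound is `2`.) -/
theorem norm_real_add_real_mul_char_le (a b : ℝ) (ha : |a| ≤ 1) (hb : |b| ≤ 1) {δ : ZMod 3} (hδ : δ ≠ 0) :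
    ‖(a : ℂ) + (b : ℂ) * (ZMod.stdAddChar δ : ℂ)‖ ≤ Real.sqrt 3 := by
  set χ : ℂ := (ZMod.stdAddChar δ : ℂ) with hχ
  have hp := norm_sign_add_real_mul_char_le (1 : ℂ) (Or.inl rfl) b hb hδ
  have hm := norm_sign_add_real_mul_char_le (-1 : ℂ) (Or.inr rfl) b hb hδ
  have ha1 : -1 ≤ a ∧ a ≤ 1 := abs_le.mp ha
  have hdec : (a : ℂ) + (b : ℂ) * χ = (((1 + a) / 2 : ℝ) : ℂ) * (1 + (b : ℂ) * χ) + (((1 - a) / 2 : ℝ) : ℂ) * (-1 + (b : ℂ) * χ) := by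
    push_cast; ring
  rw [hdec]
  have h1 : (0 : ℝ) ≤ (1 + a) / 2 := by linarith
  have h2 : (0 : ℝ) ≤ (1 - a) / 2 := by linarith
  calc ‖(((1 + a) / 2 : ℝ) : ℂ) * (1 + (b : ℂ) * χ) + (((1 - a) / 2 : ℝ) : ℂ) * (-1 + (b : ℂ) * χ)‖
      ≤ ‖(((1 + a) / 2 : ℝ) : ℂ) * (1 + (b : ℂ) * χ)‖ + ‖(((1 - a) / 2 : ℝ) : ℂ) * (-1 + (b : ℂ) * χ)‖ := norm_add_le _ _
    _ = (1 + a) / 2 * ‖1 + (b : ℂ) * χ‖ + (1 - a) / 2 * ‖-1 + (b : ℂ) * χ‖ := by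
        rw [norm_mul, norm_mul, Complex.norm_real, Complex.norm_real, Real.norm_of_nonneg h1, Real.norm_of_nonneg h2]
    _ ≤ (1 + a) / 2 * Real.sqrt 3 + (1 - a) / 2 * Real.sqrt 3 := by gcongr
    _ = Real.sqrt 3 := by ring

/-! ## The flip at one coordinate and the alignment bound -/

omit [Fintype ι] in
/-- Flipping the coordinate `i₀` is an involution of the cube. -/
theorem update_not_involutive (i₀ : ι) : Function.Involutive (fun v : ι → Bool => Function.update v i₀ (!v i₀)) := by
  intro v
  funext i
  by_cases hi : i = i₀
  · subst hi; simp
  · simp [Function.update_of_ne hi]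

/-- The phase of the flipped point differs by `ω^{±γ_{i₀}}`: `Σ_i [v'_i]γ_i = Σ_i [v_i]γ_i + (v_{i₀} ? −γ_{i₀} : γ_{i₀})`. -/
theorem sum_update_not (γ : ι → ZMod 3) (i₀ : ι) (v : ι → Bool) :
    (∑ i, if Function.update v i₀ (!v i₀) i then γ i else 0)
      = (∑ i, if v i then γ i else 0) + (if v i₀ then -γ i₀ else γ i₀) := by
  have e1 := (Finset.add_sum_erase (univ : Finset ι) (fun i => if Function.update v i₀ (!v i₀) i then γ i else 0)
    (mem_univ i₀)).symm
  have e2 := (Finset.add_sum_erase (univ : Finset ι) (fun i => if v i then γ i else 0) (mem_univ i₀)).symm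
  rw [e1, e2]
  have hrest : ∑ i ∈ univ.erase i₀, (if Function.update v i₀ (!v i₀) i then γ i else 0)
      = ∑ i ∈ univ.erase i₀, (if v i then γ i else 0) := by
    refine sum_congr rfl fun i hi => ?_
    rw [Function.update_of_ne (ne_of_mem_erase hi)]
  rw [hrest, Function.update_self]
  rcases Bool.eq_false_or_eq_true (v i₀) with h | h <;> (simp [h]; try ring)

/-- **THE REAL ALIGNMENT BOUND.**  For every real `F` with `|F| ≤ 1` on the cube `{0,1}^ι` and every frequency `γ` with some
`γ_{i₀} ≠ 0`: `‖Σ_v F(v)·ω^{Σ_i [v_i]γ_i}‖ ≤ (√3/2)·2^{|ι|}`.  (Pair `v` with its flip at `i₀`; each pair contributes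
`‖F(v) + F(v')ω^{±γ_{i₀}}‖ ≤ √3`.) -/
theorem norm_sum_real_mul_char_le (F : (ι → Bool) → ℝ) (hF : ∀ v, |F v| ≤ 1) (γ : ι → ZMod 3) {i₀ : ι}
    (hγ : γ i₀ ≠ 0) :
    ‖∑ v : ι → Bool, (F v : ℂ) * (ZMod.stdAddChar (∑ i, if v i then γ i else 0) : ℂ)‖
      ≤ Real.sqrt 3 / 2 * (2 : ℝ) ^ Fintype.card ι := by
  set Φ : (ι → Bool) → ℂ := fun v => (F v : ℂ) * (ZMod.stdAddChar (∑ i, if v i then γ i else 0) : ℂ) with hΦ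
  set fl : (ι → Bool) → (ι → Bool) := fun v => Function.update v i₀ (!v i₀) with hfl
  have hsym : ∑ v, Φ v = ∑ v, Φ (fl v) :=
    (Equiv.sum_comp (Function.Involutive.toPerm fl (update_not_involutive i₀)) Φ).symm
  have h2 : (2 : ℂ) * ∑ v, Φ v = ∑ v, (Φ v + Φ (fl v)) := by
    rw [two_mul, sum_add_distrib, ← hsym]
  have hpair : ∀ v, ‖Φ v + Φ (fl v)‖ ≤ Real.sqrt 3 := by
    intro v
    set δ : ZMod 3 := if v i₀ then -γ i₀ else γ i₀ with hδ
    have hδ0 : δ ≠ 0 := by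
      rw [hδ]; split_ifs
      · exact neg_ne_zero.mpr hγ
      · exact hγ
    have hfac : Φ v + Φ (fl v)
        = (ZMod.stdAddChar (∑ i, if v i then γ i else 0) : ℂ) *
            ((F v : ℂ) + (F (fl v) : ℂ) * (ZMod.stdAddChar δ : ℂ)) := by
      simp only [hΦ, hfl]
      rw [sum_update_not γ i₀ v, AddChar.map_add_eq_mul]
      ring
    rw [hfac, norm_mul, AffBells21.norm_stdAddChar_three, one_mul]
    exact norm_real_add_real_mul_char_le _ _ (hF v) (hF _) hδ0
  have hnorm2 : 2 * ‖∑ v, Φ v‖ = ‖∑ v, (Φ v + Φ (fl v))‖ := by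
    rw [← h2, norm_mul, RCLike.norm_ofNat]
  have hle : ‖∑ v, (Φ v + Φ (fl v))‖ ≤ Real.sqrt 3 * (2 : ℝ) ^ Fintype.card ι := by
    refine (norm_sum_le _ _).trans ?_
    calc ∑ v : ι → Bool, ‖Φ v + Φ (fl v)‖ ≤ ∑ _v : ι → Bool, Real.sqrt 3 := sum_le_sum fun v _ => hpair v
      _ = Real.sqrt 3 * (2 : ℝ) ^ Fintype.card ι := by
          rw [sum_const, card_univ, Fintype.card_fun, Fintype.card_bool, nsmul_eq_mul]
          push_cast; ring
  linarith [hnorm2, hle]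

/-- The same bound with `F` given as a complex function taking real values in `[−1,1]`. -/
theorem norm_sum_realValued_mul_char_le (G : (ι → Bool) → ℂ) (hG : ∀ v, ∃ r : ℝ, |r| ≤ 1 ∧ G v = r) (γ : ι → ZMod 3)
    {i₀ : ι} (hγ : γ i₀ ≠ 0) :
    ‖∑ v : ι → Bool, G v * (ZMod.stdAddChar (∑ i, if v i then γ i else 0) : ℂ)‖
      ≤ Real.sqrt 3 / 2 * (2 : ℝ) ^ Fintype.card ι := by
  choose F hF hGF using hG
  have e : ∑ v : ι → Bool, G v * (ZMod.stdAddChar (∑ i, if v i then γ i else 0) : ℂ)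
      = ∑ v : ι → Bool, (F v : ℂ) * (ZMod.stdAddChar (∑ i, if v i then γ i else 0) : ℂ) :=
    sum_congr rfl fun v _ => by rw [hGF v]
  rw [e]
  exact norm_sum_real_mul_char_le F hF γ hγ

end AffBells22

end Summit.QuantumAdvantage.AdviceFreeQNC0

end
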